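import Summits.NavierStokesRegularity.NavierStokesRegularity.Theorems.AdaptedFrequencyFrequencyRigidityCoRotatingKernelPush
import Summits.NavierStokesRegularity.NavierStokesRegularity.Theorems.AdaptedFrequencyFrequencyRigidityCoRotatingKernelAverage
import Mathlib.Analysis.SpecificLimits.Basic
import HarnessLib

/-!
# Crux `FrequencyRigidity` (stmt-NavierStokesRegularity-2955), wall engine, stub S5
# `stub_coRotatingKernel` — file 3/3: co-rotating kernels for rotated-self-similar drifts

Proves the registered stub `stub_coRotatingKernel` of the line `moving-adjoint-bernoulli` (the wall
engine shared with `two-ended-pinning`): the hypothesis `H(α) = Negative.CoRotatingKernelHypothesis α`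
of the refuter's wall `Negative/RSSWall.lean` (`H(α) → FrequencyRigidity → RSSLiouvilleBounded α`)
holds for EVERY angular speed `α`, GIVEN (S4) compactness of adapted kernels of a fixed drift
between two fixed Gaussians (stub `stub_kernelCompactness`, the first antecedent, verbatim) and
(AK) existence of ancient adapted Gaussian-comparable kernels for smooth divergence-free Type-I
drifts with constants depending on `(ν, C)` only (the second antecedent).

Proof (discrete averaging over the screw group; files 1/3 `…CoRotatingKernelPush`, 2/3
`…CoRotatingKernelAverage`).  Fix `α`, a smooth bounded profile `U` and `v = rss α U`, a classical
Navier–Stokes flow on `(−∞,0)`: smooth, divergence free, Type-I with the profile bound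
(`typeIBound_rss`).  (AK) gives an adapted kernel `K` between Gaussians `(c₁,c₂,C₁,C₂)`.  For
`c > 0` all pushes `g_{c^k} K` are adapted between the SAME Gaussians (screw-invariance of `v` and of
the bounds), hence so are the Cesàro averages `A_N = (N+1)⁻¹Σ_{k≤N} g_{c^k}K`; by (S4) a subsequence
converges pointwise to an adapted comparable `G_c` which is EXACTLY `g_c`-invariant
(`screw_invariant_of_tendsto_average`).  With `c_m = e^{2^{−m}}`, (S4) applied once more to
`m ↦ G_{c_m}` yields `G`, invariant under `g_{exp(k/2^m)}` for all `k, m` (each `G_{c_{m'}}`,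
`m' ≥ m`, is, by the group law), hence under `g_{e^r}` for all real `r ≥ 0` (dyadic approximation
`⌊r2^m⌋/2^m → r` and continuity of `r ↦ (g_{e^r}G)(t,x)`, `G` being jointly continuous), hence for
all `r` (`g_{c⁻¹} = g_c⁻¹`).  Invariance under `g_c` with `c = (−t)^{−1/2}` is the co-rotating shape
`G(t,x) = (−t)^{−3/2} G(−1, R(−αs)x/√(−t))` (`isCoRotating_of_screw_invariant`).

## References

* B. Pineau, V. Vicol, arXiv:2607.09619 (2026), §1.2, Conjecture 1.1. [PineauVicol2026]
* A. Friedman, *Partial Differential Equations of Parabolic Type* (1964), Ch. 1 §8. [Friedman1964]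
-/

noncomputable section

-- the problem namespace `Summit.NavierStokesRegularity.NavierStokesRegularity.…` repeats the summit name
set_option linter.dupNamespace false

namespace Summit.NavierStokesRegularity.NavierStokesRegularity.Theorems.FrequencyRigidity.MovingAdjointBernoulli

open Literature.Analysis.FluidPDE
open Summit.NavierStokesRegularity.NavierStokesRegularity.Theorems.FrequencyRigidity.Negative
open MeasureTheory Set Filter Topology Function
open scoped Laplacian InnerProductSpace RealInnerProductSpace ContDiff

/-! ### Continuity of the screw action in the group parameter -/

/-- The orbit map `θ ↦ R_θ x` is continuous (a copy of the tree's
`Literature.Analysis.FluidPDE.continuous_rotZ_angle`, kept here to avoid the heavy import closure of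
`AxisymmetricSingularSetOnAxis`). -/
-- adapted from `Literature.Analysis.FluidPDE.continuous_rotZ_angle` (AxisymmetricSingularSetOnAxis)
theorem continuous_rotZ_angle'' (x : E3) : Continuous fun θ : ℝ => rotZ θ x := by
  unfold rotZ
  refine (PiLp.continuous_toLp 2 _).comp ?_
  refine continuous_pi fun i => ?_
  have hc : Continuous fun θ : ℝ => Real.cos θ := Real.continuous_cos
  have hs : Continuous fun θ : ℝ => Real.sin θ := Real.continuous_sin
  fin_cases i
  · exact ((hc.mul (continuous_const (y := x 0))).sub
      (hs.mul (continuous_const (y := x 1)))).congr fun θ => by simp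
  · exact ((hs.mul (continuous_const (y := x 0))).add
      (hc.mul (continuous_const (y := x 1)))).congr fun θ => by simp
  · exact (continuous_const (y := x 2)).congr fun θ => by simp

/-- **Continuity of `r ↦ (g_{e^r} G)(t,x)`** for a kernel `G` jointly continuous on
`(−∞,0) × ℝ³` (the push acts through point evaluation at a continuously moving point). -/
theorem continuous_screw_exp {α : ℝ} {G : ℝ → E3 → ℝ}
    (hG : ContinuousOn (uncurry G) (Iio (0:ℝ) ×ˢ (univ : Set E3))) {t : ℝ} (ht : t < 0) (x : E3) :
    Continuous fun r : ℝ => Real.exp r ^ 3 * G (Real.exp r ^ 2 * t)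
      (rotZ (-(α * (2 * Real.log (Real.exp r)))) (Real.exp r • x)) := by
  have hpt : Continuous fun r : ℝ => ((Real.exp r ^ 2 * t,
      rotZ (-(α * (2 * Real.log (Real.exp r)))) (Real.exp r • x)) : ℝ × E3) := by
    refine ((Real.continuous_exp.pow 2).mul continuous_const).prodMk ?_
    have e : (fun r : ℝ => rotZ (-(α * (2 * Real.log (Real.exp r)))) (Real.exp r • x)) =
        fun r : ℝ => Real.exp r • rotZ (-(α * (2 * r))) x := by
      funext r
      rw [Real.log_exp, rotZ_smul_vec']
    rw [e]
    exact Real.continuous_exp.smul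
      ((continuous_rotZ_angle'' x).comp (by fun_prop : Continuous fun r : ℝ => -(α * (2 * r))))
  have hmem : ∀ r : ℝ, ((Real.exp r ^ 2 * t,
      rotZ (-(α * (2 * Real.log (Real.exp r)))) (Real.exp r • x)) : ℝ × E3) ∈
        Iio (0:ℝ) ×ˢ (univ : Set E3) :=
    fun r => ⟨mul_neg_of_pos_of_neg (pow_pos (Real.exp_pos r) 2) ht, mem_univ _⟩
  exact (Real.continuous_exp.pow 3).mul (hG.comp_continuous hpt hmem)

/-! ### From dyadic invariance to full invariance; the co-rotating shape -/

/-- **Density step.**  A jointly continuous kernel invariant under `g_{exp(k/2^m)}` for all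
`k, m : ℕ` is invariant under `g_c` for every `c ≥ 1` (`⌊2^m log c⌋/2^m → log c`). -/
theorem screw_invariant_of_dyadic {α : ℝ} {G : ℝ → E3 → ℝ}
    (hGc : ContinuousOn (uncurry G) (Iio (0:ℝ) ×ˢ (univ : Set E3)))
    (hG : ∀ m k : ℕ, ∀ t < 0, ∀ x,
      Real.exp ((k:ℝ) / 2 ^ m) ^ 3 * G (Real.exp ((k:ℝ) / 2 ^ m) ^ 2 * t)
        (rotZ (-(α * (2 * Real.log (Real.exp ((k:ℝ) / 2 ^ m))))) (Real.exp ((k:ℝ) / 2 ^ m) • x)) =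
      G t x)
    {c : ℝ} (hc : 1 ≤ c) :
    ∀ t < 0, ∀ x, c ^ 3 * G (c ^ 2 * t) (rotZ (-(α * (2 * Real.log c))) (c • x)) = G t x := by
  intro t ht x
  have hc0 : 0 < c := by linarith
  have hr : 0 ≤ Real.log c := Real.log_nonneg hc
  have hP := continuous_screw_exp (α := α) hGc ht x
  -- dyadic approximations of `log c`
  have hseq : Tendsto (fun m : ℕ => (⌊Real.log c * (2:ℝ) ^ m⌋₊ : ℝ) / (2:ℝ) ^ m) atTop
      (𝓝 (Real.log c)) :=
    (tendsto_nat_floor_mul_div_atTop hr).comp (tendsto_pow_atTop_atTop_of_one_lt one_lt_two)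
  have hlim := (hP.tendsto (Real.log c)).comp hseq
  have hconst : (fun m : ℕ => Real.exp ((⌊Real.log c * (2:ℝ) ^ m⌋₊ : ℝ) / (2:ℝ) ^ m) ^ 3 *
      G (Real.exp ((⌊Real.log c * (2:ℝ) ^ m⌋₊ : ℝ) / (2:ℝ) ^ m) ^ 2 * t)
        (rotZ (-(α * (2 * Real.log (Real.exp ((⌊Real.log c * (2:ℝ) ^ m⌋₊ : ℝ) / (2:ℝ) ^ m)))))
          (Real.exp ((⌊Real.log c * (2:ℝ) ^ m⌋₊ : ℝ) / (2:ℝ) ^ m) • x))) = fun _ => G t x :=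
    funext fun m => hG m _ t ht x
  have hlim' : Tendsto (fun _ : ℕ => G t x) atTop (𝓝 (Real.exp (Real.log c) ^ 3 *
      G (Real.exp (Real.log c) ^ 2 * t)
        (rotZ (-(α * (2 * Real.log (Real.exp (Real.log c))))) (Real.exp (Real.log c) • x)))) := by
    rw [← hconst]
    exact hlim
  have h := tendsto_nhds_unique hlim' tendsto_const_nhds
  rw [Real.exp_log hc0] at h
  exact h

/-- Invariance under `g_c` for `c ≥ 1` gives invariance for all `c > 0` (`g_{c⁻¹} = g_c⁻¹`). -/
theorem screw_invariant_all {α : ℝ} {G : ℝ → E3 → ℝ}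
    (hG : ∀ c : ℝ, 1 ≤ c → ∀ t < 0, ∀ x,
      c ^ 3 * G (c ^ 2 * t) (rotZ (-(α * (2 * Real.log c))) (c • x)) = G t x)
    {c : ℝ} (hc : 0 < c) :
    ∀ t < 0, ∀ x, c ^ 3 * G (c ^ 2 * t) (rotZ (-(α * (2 * Real.log c))) (c • x)) = G t x := by
  rcases le_or_gt 1 c with h | h
  · exact hG c h
  · have h1 : 1 ≤ c⁻¹ := (one_le_inv₀ hc).2 h.le
    have h2 := screw_inv_invariant (inv_pos.2 hc) (hG c⁻¹ h1)
    rw [inv_inv] at h2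
    exact h2

/-- **The co-rotating shape from screw-invariance**: `g_c G = G` for all `c > 0` gives, with
`c = (−t)^{−1/2}` (so `c²t = −1`, `−2α log c = α log(−t) = −rotAngle α t`),
`G(t,x) = sc(t)³ G(−1, R_{−θ(t)}(sc(t) x))`. -/
theorem isCoRotating_of_screw_invariant {α : ℝ} {G : ℝ → E3 → ℝ}
    (hG : ∀ c : ℝ, 0 < c → ∀ t < 0, ∀ x,
      c ^ 3 * G (c ^ 2 * t) (rotZ (-(α * (2 * Real.log c))) (c • x)) = G t x) :
    IsCoRotating α G := by
  intro t ht x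
  have hsc := sc_pos (neg_pos.2 ht)
  have h := (hG (sc t) hsc t ht x).symm
  have h1 : sc t ^ 2 * t = -1 := by
    rw [sq, sc_mul_sc ht, inv_mul_eq_div, div_neg_self ht.ne]
  have h2 : α * (2 * Real.log (sc t)) = rotAngle α t := by
    rw [rotAngle, sc, Real.log_inv, Real.log_sqrt (by linarith : (0:ℝ) ≤ -t)]
    ring
  rw [h1, h2] at h
  exact h

/-- The Gaussian upper bound is at most `C₁(−t)^{−3/2}` (`exp ≤ 1` of a nonpositive argument). -/
theorem gaussian_upper_le {C₁ C₂ t : ℝ} (hC₁ : 0 ≤ C₁) (hC₂ : 0 ≤ C₂) (ht : t < 0) (x : E3) :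
    C₁ * ((0:ℝ) - t) ^ (-(3:ℝ) / 2) * Real.exp (-(‖x - (0 : E3)‖ ^ 2) / (C₂ * ((0:ℝ) - t))) ≤
      C₁ * ((0:ℝ) - t) ^ (-(3:ℝ) / 2) := by
  refine mul_le_of_le_one_right (mul_nonneg hC₁ (Real.rpow_nonneg (by linarith) _))
    (Real.exp_le_one_iff.2 ?_)
  exact div_nonpos_of_nonpos_of_nonneg (neg_nonpos.2 (sq_nonneg _)) (mul_nonneg hC₂ (by linarith))

/-! ### The stub -/

/-- **Stub S5 `stub_coRotatingKernel` (wall engine): co-rotating adapted kernels for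
rotated-self-similar drifts.**  Assuming (S4) compactness of adapted kernels of a fixed smooth
divergence-free locally bounded drift on `(−∞,0)` between two fixed Gaussians (stub
`stub_kernelCompactness`, verbatim) and (AK) existence of ancient adapted Gaussian-comparable
kernels for smooth divergence-free Type-I drifts with constants depending only on `(ν, C)`, the
wall's hypothesis `Negative.CoRotatingKernelHypothesis α` holds for every `α`: every smooth profile
`U` with `U, DU` bounded whose RSS field `rss α U` is a classical Navier–Stokes flow on `(−∞,0)`
admits an adapted backward kernel at `(0,0)`, Gaussian-comparable and CO-ROTATING.  Proof: Cesàro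
averages over the discrete screw subgroups `{g_{c^k}}` of an (AK)-kernel, two (S4)-extractions
(`c = e^{2^{−m}}`, then `m → ∞`), dyadic density and `g_{(−t)^{−1/2}}`-invariance (module
docstring). -/
theorem stub_coRotatingKernel :
    (∀ (ν c₁ c₂ C₁ C₂ : ℝ) (v : ℝ → EuclideanSpace ℝ (Fin 3) → EuclideanSpace ℝ (Fin 3)) (K : ℕ → ℝ → EuclideanSpace ℝ (Fin 3) → ℝ),
      0 < ν → 0 < c₁ → 0 < c₂ → 0 < C₁ → 0 < C₂ →
      Literature.Analysis.FluidPDE.IsSmoothSpaceTimeOn (Set.Iio 0) v →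
      (∀ t ∈ Set.Iio (0:ℝ), Literature.Analysis.FluidPDE.VectorCalculus.IsDivFree (v t)) →
      (∀ a b : ℝ, a < b → b < 0 → ∃ B : ℝ, ∀ t ∈ Set.Icc a b, ∀ x, ‖v t x‖ ≤ B) →
      (∀ n : ℕ, Literature.Analysis.FluidPDE.IsAdaptedBackwardKernel ν v (Set.Ico (-(n:ℝ) - 1) 0) 0 0 (K n) ∧
        ∀ t ∈ Set.Ico (-(n:ℝ) - 1) (0:ℝ), ∀ x,
          c₁ * ((0:ℝ) - t) ^ (-(3:ℝ) / 2) * Real.exp (-(‖x - (0 : EuclideanSpace ℝ (Fin 3))‖ ^ 2) / (c₂ * ((0:ℝ) - t))) ≤ K n t x ∧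
          K n t x ≤ C₁ * ((0:ℝ) - t) ^ (-(3:ℝ) / 2) * Real.exp (-(‖x - (0 : EuclideanSpace ℝ (Fin 3))‖ ^ 2) / (C₂ * ((0:ℝ) - t)))) →
      ∃ (G : ℝ → EuclideanSpace ℝ (Fin 3) → ℝ) (φ : ℕ → ℕ), StrictMono φ ∧
        Literature.Analysis.FluidPDE.IsAdaptedBackwardKernel ν v (Set.Iio 0) 0 0 G ∧
        (∀ t ∈ Set.Iio (0:ℝ), ∀ x,
          c₁ * ((0:ℝ) - t) ^ (-(3:ℝ) / 2) * Real.exp (-(‖x - (0 : EuclideanSpace ℝ (Fin 3))‖ ^ 2) / (c₂ * ((0:ℝ) - t))) ≤ G t x ∧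
          G t x ≤ C₁ * ((0:ℝ) - t) ^ (-(3:ℝ) / 2) * Real.exp (-(‖x - (0 : EuclideanSpace ℝ (Fin 3))‖ ^ 2) / (C₂ * ((0:ℝ) - t)))) ∧
        (∀ t ∈ Set.Iio (0:ℝ), ∀ x,
          Filter.Tendsto (fun n => K (φ n) t x) Filter.atTop (nhds (G t x)))) →
    (∀ (ν C : ℝ), 0 < ν → 0 ≤ C → ∃ c₁ c₂ C₁ C₂ : ℝ, 0 < c₁ ∧ 0 < c₂ ∧ 0 < C₁ ∧ 0 < C₂ ∧
      ∀ (v : ℝ → EuclideanSpace ℝ (Fin 3) → EuclideanSpace ℝ (Fin 3)),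
        Literature.Analysis.FluidPDE.IsSmoothSpaceTimeOn (Set.Iio 0) v →
        (∀ t ∈ Set.Iio (0:ℝ), Literature.Analysis.FluidPDE.VectorCalculus.IsDivFree (v t)) →
        Literature.Analysis.FluidPDE.HasTypeITimeDecay C v →
        ∃ G : ℝ → EuclideanSpace ℝ (Fin 3) → ℝ, Literature.Analysis.FluidPDE.IsAdaptedBackwardKernel ν v (Set.Iio 0) 0 0 G ∧
          ∀ t ∈ Set.Iio (0:ℝ), ∀ x,
            c₁ * ((0:ℝ) - t) ^ (-(3:ℝ) / 2) * Real.exp (-(‖x - (0 : EuclideanSpace ℝ (Fin 3))‖ ^ 2) / (c₂ * ((0:ℝ) - t))) ≤ G t x ∧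
            G t x ≤ C₁ * ((0:ℝ) - t) ^ (-(3:ℝ) / 2) * Real.exp (-(‖x - (0 : EuclideanSpace ℝ (Fin 3))‖ ^ 2) / (C₂ * ((0:ℝ) - t)))) →
    ∀ α : ℝ, Negative.CoRotatingKernelHypothesis α := by
  intro hS4 hAK α U q hU hbd hNS
  obtain ⟨C, hC⟩ := hbd
  -- the drift `v = rss α U`: smooth, divergence free, Type-I, locally bounded
  have hv : IsSmoothSpaceTimeOn (Iio 0) (rss α U) := hNS.smooth_velocity
  have hdiv : ∀ t ∈ Iio (0:ℝ), VectorCalculus.IsDivFree (rss α U t) := hNS.divFree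
  have hC0 : 0 ≤ C := (norm_nonneg _).trans (hC 0).1
  have hTI : HasTypeITimeDecay C (rss α U) := fun t ht x =>
    typeIBound_rss (α := α) (fun y => (hC y).1) t ht x
  have hloc : ∀ a b : ℝ, a < b → b < 0 → ∃ B : ℝ, ∀ t ∈ Icc a b, ∀ x, ‖rss α U t x‖ ≤ B := by
    intro a b _ hb
    refine ⟨C / Real.sqrt (-b), fun t ht x => (hTI t (lt_of_le_of_lt ht.2 hb) x).trans ?_⟩
    exact div_le_div_of_nonneg_left hC0 (Real.sqrt_pos.2 (by linarith))
      (Real.sqrt_le_sqrt (by linarith [ht.2]))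
  -- (1) an ancient adapted comparable kernel of `v`
  obtain ⟨c₁, c₂, C₁, C₂, hc₁, hc₂, hC₁, hC₂, hK⟩ := hAK 1 C one_pos hC0
  obtain ⟨K, hK, hKb⟩ := hK (rss α U) hv hdiv hTI
  -- (S4) for kernels given on all of `(−∞,0)`
  have extract : ∀ F : ℕ → ℝ → E3 → ℝ,
      (∀ n, IsAdaptedBackwardKernel 1 (rss α U) (Iio 0) 0 0 (F n)) →
      (∀ n, ∀ t ∈ Iio (0:ℝ), ∀ x,
        c₁ * ((0:ℝ) - t) ^ (-(3:ℝ) / 2) * Real.exp (-(‖x - (0 : E3)‖ ^ 2) / (c₂ * ((0:ℝ) - t))) ≤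
            F n t x ∧
          F n t x ≤
            C₁ * ((0:ℝ) - t) ^ (-(3:ℝ) / 2) * Real.exp (-(‖x - (0 : E3)‖ ^ 2) / (C₂ * ((0:ℝ) - t)))) →
      ∃ (G : ℝ → E3 → ℝ) (φ : ℕ → ℕ), StrictMono φ ∧
        IsAdaptedBackwardKernel 1 (rss α U) (Iio 0) 0 0 G ∧
        (∀ t ∈ Iio (0:ℝ), ∀ x,
          c₁ * ((0:ℝ) - t) ^ (-(3:ℝ) / 2) * Real.exp (-(‖x - (0 : E3)‖ ^ 2) / (c₂ * ((0:ℝ) - t))) ≤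
              G t x ∧
            G t x ≤
              C₁ * ((0:ℝ) - t) ^ (-(3:ℝ) / 2) * Real.exp (-(‖x - (0 : E3)‖ ^ 2) / (C₂ * ((0:ℝ) - t)))) ∧
        (∀ t ∈ Iio (0:ℝ), ∀ x, Tendsto (fun n => F (φ n) t x) atTop (𝓝 (G t x))) :=
    fun F hF hFb => hS4 1 c₁ c₂ C₁ C₂ (rss α U) F one_pos hc₁ hc₂ hC₁ hC₂ hv hdiv hloc
      (fun n => ⟨(hF n).mono Ico_subset_Iio_self (uniqueDiffOn_Ico _ _),
        fun t ht x => hFb n t (Ico_subset_Iio_self ht) x⟩)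
  -- (2) for every `c > 0`: a `g_c`-invariant adapted comparable kernel
  have step : ∀ c : ℝ, 0 < c → ∃ G : ℝ → E3 → ℝ,
      IsAdaptedBackwardKernel 1 (rss α U) (Iio 0) 0 0 G ∧
      (∀ t ∈ Iio (0:ℝ), ∀ x,
        c₁ * ((0:ℝ) - t) ^ (-(3:ℝ) / 2) * Real.exp (-(‖x - (0 : E3)‖ ^ 2) / (c₂ * ((0:ℝ) - t))) ≤
            G t x ∧
          G t x ≤
            C₁ * ((0:ℝ) - t) ^ (-(3:ℝ) / 2) * Real.exp (-(‖x - (0 : E3)‖ ^ 2) / (C₂ * ((0:ℝ) - t)))) ∧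
      (∀ t < 0, ∀ x, c ^ 3 * G (c ^ 2 * t) (rotZ (-(α * (2 * Real.log c))) (c • x)) = G t x) := by
    intro c hc
    have hPk : ∀ k : ℕ, IsAdaptedBackwardKernel 1 (rss α U) (Iio 0) 0 0
        (fun t x => (c ^ k) ^ 3 * K ((c ^ k) ^ 2 * t)
          (rotZ (-(α * (2 * Real.log (c ^ k)))) ((c ^ k) • x))) :=
      fun k => isAdaptedBackwardKernel_screw (pow_pos hc k) (rss_screw α U (pow_pos hc k)) hK
    have hPb := fun k : ℕ => screw_bounds (K := K) (θ := α * (2 * Real.log (c ^ k)))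
      (c₁ := c₁) (c₂ := c₂) (C₁ := C₁) (C₂ := C₂) (pow_pos hc k) hKb
    have hAk := fun N : ℕ => isAdaptedBackwardKernel_average N hPk
    have hAb := fun N : ℕ => average_bounds N hPb
    obtain ⟨G, φ, hφ, hG, hGb, hlim⟩ := extract _ hAk hAb
    refine ⟨G, hG, hGb, screw_invariant_of_tendsto_average (C := C₁) hc hφ
      (fun k t ht x => ⟨((hPk k).pos t ht x).le,
        ((hPb k t ht x).2).trans (gaussian_upper_le hC₁.le hC₂.le ht x)⟩)
      (fun t ht x => hlim t ht x)⟩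
  -- (3) nested dyadic subgroups and the second extraction
  choose Gm hGm hGmb hGmi using fun m : ℕ => step (Real.exp (1 / (2:ℝ) ^ m)) (Real.exp_pos _)
  obtain ⟨G, ψ, hψ, hG, hGb, hlim⟩ := extract Gm hGm hGmb
  have hGdy : ∀ m k : ℕ, ∀ t < 0, ∀ x,
      Real.exp ((k:ℝ) / 2 ^ m) ^ 3 * G (Real.exp ((k:ℝ) / 2 ^ m) ^ 2 * t)
        (rotZ (-(α * (2 * Real.log (Real.exp ((k:ℝ) / 2 ^ m))))) (Real.exp ((k:ℝ) / 2 ^ m) • x)) =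
      G t x := by
    intro m k t ht x
    have hs : Real.exp ((k:ℝ) / 2 ^ m) ^ 2 * t < 0 :=
      mul_neg_of_pos_of_neg (pow_pos (Real.exp_pos _) 2) ht
    -- every `Gm (ψ n)`, `n ≥ m`, is invariant under `g_{exp(k/2^m)}`
    have hinv : ∀ n, m ≤ n →
        Real.exp ((k:ℝ) / 2 ^ m) ^ 3 * Gm (ψ n) (Real.exp ((k:ℝ) / 2 ^ m) ^ 2 * t)
          (rotZ (-(α * (2 * Real.log (Real.exp ((k:ℝ) / 2 ^ m))))) (Real.exp ((k:ℝ) / 2 ^ m) • x)) =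
        Gm (ψ n) t x := by
      intro n hn
      have hmn : m ≤ ψ n := hn.trans hψ.le_apply
      have h := screw_pow_invariant (Real.exp_pos _) (hGmi (ψ n)) (k * 2 ^ (ψ n - m)) t ht x
      have he : Real.exp (1 / (2:ℝ) ^ ψ n) ^ (k * 2 ^ (ψ n - m)) = Real.exp ((k:ℝ) / 2 ^ m) := by
        rw [← Real.exp_nat_mul]
        congr 1
        push_cast
        rw [pow_sub₀ (2:ℝ) two_ne_zero hmn]
        field_simp
      rw [he] at h
      exact h
    have hA := (hlim _ hs (rotZ (-(α * (2 * Real.log (Real.exp ((k:ℝ) / 2 ^ m)))))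
      (Real.exp ((k:ℝ) / 2 ^ m) • x))).const_mul (Real.exp ((k:ℝ) / 2 ^ m) ^ 3)
    have hB := hlim t ht x
    have hA' : Tendsto (fun n => Gm (ψ n) t x) atTop (𝓝 (Real.exp ((k:ℝ) / 2 ^ m) ^ 3 *
        G (Real.exp ((k:ℝ) / 2 ^ m) ^ 2 * t)
          (rotZ (-(α * (2 * Real.log (Real.exp ((k:ℝ) / 2 ^ m))))) (Real.exp ((k:ℝ) / 2 ^ m) • x)))) :=
      hA.congr' (eventually_atTop.2 ⟨m, fun n hn => hinv n hn⟩)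
    exact tendsto_nhds_unique hA' hB
  -- (4) full invariance and the co-rotating shape
  have hall : ∀ c : ℝ, 0 < c → ∀ t < 0, ∀ x,
      c ^ 3 * G (c ^ 2 * t) (rotZ (-(α * (2 * Real.log c))) (c • x)) = G t x :=
    fun c hc => screw_invariant_all
      (fun c' hc' => screw_invariant_of_dyadic hG.contDiffOn.continuousOn hGdy hc') hc
  exact ⟨G, hG, isGaussianComparable_iff_fin_three.2 ⟨c₁, c₂, C₁, C₂, hc₁, hc₂, hC₁, hC₂, hGb⟩,
    isCoRotating_of_screw_invariant hall⟩

end Summit.NavierStokesRegularity.NavierStokesRegularity.Theorems.FrequencyRigidity.MovingAdjointBernoulli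

end
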